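import Summits.QuantumFields.BalabanUV.Beta.EriceFlowEnclosureB12AsPrintedPointwiseFadingLimit

/-!
# Beta / EriceFlowEnclosureB12AsPrintedPointwiseFadingZeroHistory — WHAT (0.31) FORCES, part 13: THE ZERO-HISTORY VALUES.
# node U2's coupling-chart letters MANUFACTURE [I]'s one-loop split (2.12)–(2.14): under `HistLipschitz Λ γ β` + `FadingMemory C θ Λ` ALONE (0 ≤ θ < 1; NO NE4) every
# history-dependent β-function has ONE value at the zero history, a number `b⁰_k` with
#   **`|β_{k+1}(u,…,u) − b⁰_k| ≤ Cu∕(1−θ)`  (u ∈ ]0, γ])**   (§1 `exists_zeroHist`, unique, the right limit at 0),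
# and the FADING CORNER BOUND
#   **`|β_{k+1}(v) − b⁰_k| ≤ Σ_{i≤k} Λ_{k,i}·v_i ≤ C·Σ_{i≤k} θ^{k−i}·v_i`  for every `v ∈ ]0, γ]^{k+1}`**   (§2)
# — so `β_{k+1} = b⁰_k + (β_{k+1} − b⁰_k)` is an INTRINSIC split into a history-free part and a part vanishing at the zero corner, with (AF-1) in a FADING form (`≤ Cδ∕(1−θ)` on
# ]0, δ]^{k+1}; `≤ C·v_k∕(1−θ)` — the printed last-coupling shape — along non-decreasing histories).  With NE4 `ScaleShiftRate c θ γ β` the history-free part obeys the INTRINSIC (AF-0r)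
#   **`|b⁰_{k+1} − b⁰_k| ≤ cθ^k`,  `|b⁰_k − b⋆| ≤ cθ^k∕(1−θ)`**   (§3; `b⋆` = part 11's asymptotic constant, `hb`) — the zero-history values converge to THE one number at NE4's rate —
# and every β-value has the THREE-TERM NORMAL FORM `β_{k+1}(v) = b⋆ + (b⁰_k − b⋆) + (β_{k+1}(v) − b⁰_k)` with a SUMMABLE scale term (`Σ_j |b⁰_j − b⋆| ≤ c∕(1−θ)²`) and a fading history
# term (§4): part 11's sandwich constant `2Cδ∕(1−θ)` HALVES (`abs_beta_sub_bstar_le'`), and along any coupling sequence the window sums of K1⁹'s row (iv) are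
# `b⋆·(n−k) + Σ(history term) + O(c∕(1−θ)²)` (`abs_windowSum_sub_le`) — so AT THE BOUNDARY `b⋆ = 0` (gen 50's open question) row (iv) is a property of the HISTORY TERM alone;
# part 13b `…ZeroHistoryBoundary` decides it there.
# (β-flow team, prover 2 = lower ∕ positivity side, unit `b2b-balaban-beta-bflow-p2`, gen 51; ROW AP-I × node U2's letters; kernel of part 13)

HONEST FRAMING (page 1 of everything the β sub-cell writes): discharging `BetaPertH` makes Bałaban's UV stability UNCONDITIONAL — a
real constructive-QFT result; it is NOT the continuum limit and NOT the Clay problem.  HONEST DEPENDENCY (cell reorg 2026-08-19,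
verbatim): «continuum YM on T⁴ ⇐ BetaPertH ∧ nine spine estimates (0/9 proved); BetaPertH ⇐ (D1) ∧ (D4) ∧ CAP+tail; G-an2-4 gates
asym, D1 and NE2/3/4.»  THIS MODULE DISCHARGES NOTHING: [folklore] limit ∕ finite-sum calculus for an ABSTRACT `β : FlowStep.HBeta` under node U2's HYPOTHESIS SHAPES
`T4CouplingMatching.HistLipschitz ∕ FadingMemory ∕ ScaleShiftRate` (NONE printed — [Balaban1987RG1] = T. Bałaban, Commun. Math. Phys. **109** (1987) p. 298 says only that β_j
*"depends also on all preceding coupling constants"*, p. 264 *"We will investigate other properties in a separate paper"*; GAPS G-t4-U2-1 ∕ G-t4-U2-2).  The printed one-loop split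
(2.12)–(2.14) p. 268 (tree: `B12Beta.OneLoopSplit`, a structure whose `vanish` field reads β OFF the box, AT the face `g_k = 0`) is NOT instantiated here, and the manufactured pair
`(b⁰, β − b⁰)` is NOT a `OneLoopSplit β` unless `β_{k+1}(p) = b⁰_k` for every p with `p_k = 0` (part 13d builds the structure only for a box-equivalent family; at the RECORD the split's
numbers are zero-EDGE limits, outside every box — b2b-an4 WORD-1, CLAIMS l.68389): the zero-history values `b⁰` are carried as a sequence `b0 : ℕ → ℝ` with a DISPLAYED property (`hb0`,
supplied by `exists_zeroHist`, unique by `zeroHist_unique`) — no definition is introduced, exactly as part 11 carries `b⋆`.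
Part 11's `abs_const_sub_const_le` ∕ `abs_const_sub_betaInf_le` ∕ `rowSum_le` (part 6) and node U2's `T4EtaRateMin.exists_limit_of_geomRate` are used BY NAME; nothing of theirs is restated.
bflow-p1's `…HistoryContagionShiftFlowZero.exists_valueAtZero` (#68a) is the analogous statement for ONE fading-memory FUNCTIONAL on infinite histories (their β₀ for `betaInf β` is `b⋆`,
part 11i); here the values are per SCALE, for the lattice family itself.  Nothing is asserted about Bałaban's β-functions (1.22), their values at zero coupling, sign, moduli or rate.

WHAT THIS FILE PROVES (0 sorry, 0 def):
§0 `exists_small_const`, `eq_of_abs_sub_le_linear`, `tendsto_of_abs_sub_le_linear`, **`exists_value_of_lipschitzOn`** (a function Lipschitz on ]0, γ] has ONE value at 0⁺, approached linearly) — generic.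
§1 **`exists_zeroHist`** (∃ b⁰ with `|β_{k+1}(u,…,u) − b⁰_k| ≤ Cu∕(1−θ)` on ]0, γ], every k), `zeroHist_unique_at` ∕ `zeroHist_unique`, `tendsto_const_zeroHist`.
§2 **`abs_sub_zeroHist_le_sum_moduli`** (`≤ Σ Λ_{k,i} v_i`), **`abs_sub_zeroHist_le_sum_geom`** (`≤ CΣθ^{k−i}v_i`), `abs_sub_zeroHist_le_box` (`≤ Cδ∕(1−θ)`),
   `abs_sub_zeroHist_le_last_of_monotone` (`≤ C·v_k∕(1−θ)` on non-decreasing histories — the printed (AF-1) shape).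
§3 **`abs_zeroHist_succ_sub_le`** (NE4 ⟹ `|b⁰_{k+1} − b⁰_k| ≤ cθ^k`), **`abs_zeroHist_sub_bstar_le`** (`|b⁰_k − b⋆| ≤ cθ^k∕(1−θ)`), `tendsto_zeroHist_bstar`, `limit_zeroHist_eq_bstar`.
§4 **`abs_beta_sub_bstar_le'`** (the sandwich with constant `Cδ∕(1−θ) + cθ^k∕(1−θ)`), `sum_abs_zeroHist_sub_bstar_le` (`Σ_{j∈[k,n)} |b⁰_j − b⋆| ≤ cθ^k∕(1−θ)²`),
   **`abs_windowSum_sub_le`** (window sums = `b⋆(n−k) + Σ(history term)` up to `cθ^k∕(1−θ)²`).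
NOT CLAIMED: the existence, value or sign of such values for Bałaban's β; `OneLoopSplit` for it; which reading print intends; Theorem 2; `BetaPertH`; continuum; Clay.
-/

namespace Summit.QuantumFields.BalabanUV.Beta.EriceFlowEnclosureB12AsPrintedPointwiseFadingZeroHistory

open Finset Filter Topology
open Literature.MathematicalPhysics.QuantumFieldTheory.Balaban1983to89
open Literature.MathematicalPhysics.QuantumFieldTheory.Balaban1983to89.FlowStep (HBeta prefixOf Box mem_box box_mono RGEqH)
open Literature.MathematicalPhysics.QuantumFieldTheory.Balaban1983to89.T4CouplingMatching (HistLipschitz FadingMemory ScaleShiftRate)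
open Literature.MathematicalPhysics.QuantumFieldTheory.Balaban1983to89.T4BetaStationary (betaInf constant_nonneg_of_scaleShiftRate)
open Literature.MathematicalPhysics.QuantumFieldTheory.Balaban1983to89.T4CauchySum (GeomRate)
open Literature.MathematicalPhysics.QuantumFieldTheory.Balaban1983to89.T4EtaRateMin (exists_limit_of_geomRate)
open Summit.QuantumFields.BalabanUV.Beta.EriceFlowEnclosureB12AsPrintedPointwiseFading (rowSum_le)
open Summit.QuantumFields.BalabanUV.Beta.EriceFlowEnclosureB12AsPrintedPointwiseFadingLimit (abs_const_sub_const_le abs_const_sub_betaInf_le)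

noncomputable section

/-! ## §0 Generic: a function Lipschitz on ]0, γ] has one value at 0⁺, approached linearly -/

/-- An auxiliary constant history: for `ε > 0` some `u ∈ ]0, γ]` has `2Cu∕(1−θ) ≤ ε` (`0 ≤ C`, `θ < 1`). [folklore] -/
theorem exists_small_const {γ C θ ε : ℝ} (hγ : 0 < γ) (hC : 0 ≤ C) (hθ1 : θ < 1) (hε : 0 < ε) :
    ∃ u : ℝ, 0 < u ∧ u ≤ γ ∧ 2 * C * u / (1 - θ) ≤ ε := by
  have h1θ : 0 < 1 - θ := by linarith
  refine ⟨min γ (ε * (1 - θ) / (2 * (C + 1))), lt_min hγ (by positivity), min_le_left _ _, ?_⟩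
  have hu : 0 < min γ (ε * (1 - θ) / (2 * (C + 1))) := lt_min hγ (by positivity)
  have h2 : min γ (ε * (1 - θ) / (2 * (C + 1))) ≤ ε * (1 - θ) / (2 * (C + 1)) := min_le_right _ _
  have h4 : 2 * (C + 1) * min γ (ε * (1 - θ) / (2 * (C + 1))) ≤ ε * (1 - θ) := by
    rwa [le_div_iff₀ (by positivity), mul_comm] at h2
  rw [div_le_iff₀ h1θ]
  nlinarith [hu.le]

/-- Two numbers approached linearly by the same function at `0⁺` (possibly with different constants) coincide. [folklore] -/
theorem eq_of_abs_sub_le_linear {f : ℝ → ℝ} {γ K₁ K₂ b₁ b₂ : ℝ} (hγ : 0 < γ) (hK₁ : 0 ≤ K₁) (hK₂ : 0 ≤ K₂)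
    (h₁ : ∀ u : ℝ, 0 < u → u ≤ γ → |f u - b₁| ≤ K₁ * u) (h₂ : ∀ u : ℝ, 0 < u → u ≤ γ → |f u - b₂| ≤ K₂ * u) :
    b₁ = b₂ := by
  have key : ∀ ε : ℝ, 0 < ε → |b₁ - b₂| ≤ ε := by
    intro ε hε
    set u : ℝ := min γ (ε / (K₁ + K₂ + 1)) with hudef
    have hu : 0 < u := lt_min hγ (by positivity)
    have huγ : u ≤ γ := min_le_left _ _
    have huε : u ≤ ε / (K₁ + K₂ + 1) := min_le_right _ _
    have h3 : (K₁ + K₂ + 1) * u ≤ ε := by rwa [le_div_iff₀ (by positivity), mul_comm] at huε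
    have htri : |b₁ - b₂| ≤ |f u - b₁| + |f u - b₂| := by
      rw [abs_sub_comm (f u) b₁]; exact abs_sub_le b₁ (f u) b₂
    nlinarith [h₁ u hu huγ, h₂ u hu huγ, htri, hu.le]
  have h0 : |b₁ - b₂| ≤ 0 := le_of_forall_pos_le_add fun ε hε => by linarith [key ε hε]
  exact sub_eq_zero.mp (abs_nonpos_iff.mp h0)

/-- The number approached linearly at `0⁺` is the right limit. [folklore] -/
theorem tendsto_of_abs_sub_le_linear {f : ℝ → ℝ} {γ K b : ℝ} (hγ : 0 < γ) (hK : 0 ≤ K)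
    (h : ∀ u : ℝ, 0 < u → u ≤ γ → |f u - b| ≤ K * u) : Tendsto f (𝓝[>] 0) (𝓝 b) := by
  rw [Metric.tendsto_nhdsWithin_nhds]
  intro ε hε
  refine ⟨min γ (ε / (K + 1)), lt_min hγ (by positivity), fun u hu hdist => ?_⟩
  have hu0 : 0 < u := hu
  rw [Real.dist_eq, sub_zero, abs_of_pos hu0] at hdist
  have huγ : u ≤ γ := (hdist.trans_le (min_le_left _ _)).le
  have huε : u < ε / (K + 1) := hdist.trans_le (min_le_right _ _)
  rw [Real.dist_eq]
  refine (h u hu0 huγ).trans_lt ?_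
  have h3 : (K + 1) * u < ε := by rwa [lt_div_iff₀ (by positivity), mul_comm] at huε
  nlinarith [hu0.le]

/-- **A function `K`-Lipschitz on ]0, γ] has ONE VALUE AT `0⁺`, approached linearly**: `∃ b, |f u − b| ≤ K·u` for `u ∈ ]0, γ]` (Cauchy along `γ∕2ⁿ`, node U2's
`exists_limit_of_geomRate` BY NAME, then `|f u − b| ≤ |f u − f(γ∕2ⁿ)| + |f(γ∕2ⁿ) − b|` for every n). [folklore] -/
theorem exists_value_of_lipschitzOn {f : ℝ → ℝ} {γ K : ℝ} (hγ : 0 < γ) (hK : 0 ≤ K)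
    (hf : ∀ u u' : ℝ, 0 < u → u ≤ γ → 0 < u' → u' ≤ γ → |f u - f u'| ≤ K * |u - u'|) :
    ∃ b : ℝ, ∀ u : ℝ, 0 < u → u ≤ γ → |f u - b| ≤ K * u := by
  set a : ℕ → ℝ := fun n => f (γ * (1 / 2) ^ n) with ha
  have hun : ∀ n : ℕ, 0 < γ * (1 / 2 : ℝ) ^ n ∧ γ * (1 / 2 : ℝ) ^ n ≤ γ := fun n =>
    ⟨by positivity, by
      have : (1 / 2 : ℝ) ^ n ≤ 1 := pow_le_one₀ (by norm_num) (by norm_num)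
      nlinarith⟩
  have hgeom : GeomRate (K * γ / 2) (1 / 2) (fun n => a (n + 1) - a n) := by
    intro n
    have h := hf _ _ (hun (n + 1)).1 (hun (n + 1)).2 (hun n).1 (hun n).2
    have hdiff : |γ * (1 / 2 : ℝ) ^ (n + 1) - γ * (1 / 2) ^ n| = γ * (1 / 2) ^ (n + 1) := by
      have hp : 0 ≤ γ * (1 / 2 : ℝ) ^ n := by positivity
      rw [abs_sub_comm, abs_of_nonneg (by rw [pow_succ]; nlinarith)]
      ring
    rw [hdiff] at h
    calc |a (n + 1) - a n| ≤ K * (γ * (1 / 2) ^ (n + 1)) := h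
      _ = K * γ / 2 * (1 / 2) ^ n := by rw [pow_succ]; ring
  obtain ⟨b, -, hb⟩ := exists_limit_of_geomRate (u := a) (by norm_num : (1 / 2 : ℝ) < 1) hgeom
  refine ⟨b, fun u hu huγ => ?_⟩
  refine le_of_forall_pos_le_add fun ε hε => ?_
  have hn : ∀ n : ℕ, |f u - b| ≤ K * u + 2 * K * γ * (1 / 2) ^ n := by
    intro n
    have h1 := hf u _ hu huγ (hun n).1 (hun n).2
    have h2 := hb n
    have htri := abs_sub_le (f u) (a n) b
    have habs : |u - γ * (1 / 2) ^ n| ≤ u + γ * (1 / 2) ^ n :=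
      abs_sub_le_iff.mpr ⟨by linarith [(hun n).1], by linarith [hu]⟩
    have h1' : |f u - a n| ≤ K * (u + γ * (1 / 2) ^ n) := h1.trans (mul_le_mul_of_nonneg_left habs hK)
    have h2' : |a n - b| ≤ K * γ * (1 / 2) ^ n := by
      refine h2.trans (le_of_eq ?_)
      field_simp
      ring
    have e : K * (u + γ * (1 / 2) ^ n) + K * γ * (1 / 2) ^ n = K * u + 2 * K * γ * (1 / 2) ^ n := by ring
    linarith [htri, h1', h2', e]
  rcases eq_or_lt_of_le (show 0 ≤ 2 * K * γ by positivity) with h0 | hpos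
  · have := hn 0
    rw [pow_zero, mul_one] at this
    linarith
  · obtain ⟨n, hnε⟩ := exists_pow_lt_of_lt_one (show 0 < ε / (2 * K * γ) by positivity) (by norm_num : (1 / 2 : ℝ) < 1)
    have : 2 * K * γ * (1 / 2) ^ n < ε := by
      have := (lt_div_iff₀ hpos).mp hnε
      linarith
    linarith [hn n]

variable {β : HBeta} {γ C c θ : ℝ} {Λ : ℕ → ℕ → ℝ}

/-! ## §1 The zero-history values `b⁰_k` of a family with fading coupling-chart moduli (NO NE4) -/

/-- **THE ZERO-HISTORY VALUES EXIST.**  Under node U2's `HistLipschitz Λ γ β` with `FadingMemory C θ Λ` (0 ≤ θ < 1, 0 ≤ C, 0 < γ) — NO scale-shift rate — there is a sequence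
`b⁰ : ℕ → ℝ` with **`|β_{k+1}(u,…,u) − b⁰_k| ≤ Cu∕(1−θ)` for every k and every `u ∈ ]0, γ]`**: `u ↦ β_{k+1}(u,…,u)` is `C∕(1−θ)`-Lipschitz uniformly in k (part 11's
`abs_const_sub_const_le`), so §0 applies scale by scale.  `b⁰_k` is "β_{k+1} at zero coupling" — the intrinsic reading of [I]'s one-loop coefficient `β⁰_{k+1}` of (2.12)–(2.14); nothing
of the kind is asserted for Bałaban's (1.22). [cite: Balaban1987RG1, (2.12)-(2.14) p.268 and §5 p.298] -/
theorem exists_zeroHist (hL : HistLipschitz Λ γ β) (hΛ : FadingMemory C θ Λ) (hθ0 : 0 ≤ θ) (hθ1 : θ < 1) (hC : 0 ≤ C) (hγ : 0 < γ) :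
    ∃ b0 : ℕ → ℝ, ∀ (k : ℕ) (u : ℝ), 0 < u → u ≤ γ → |β k (fun _ : Fin (k + 1) => u) - b0 k| ≤ C * u / (1 - θ) := by
  have h1θ : 0 < 1 - θ := by linarith
  have h : ∀ k : ℕ, ∃ b : ℝ, ∀ u : ℝ, 0 < u → u ≤ γ → |β k (fun _ : Fin (k + 1) => u) - b| ≤ C * u / (1 - θ) := by
    intro k
    obtain ⟨b, hb⟩ := exists_value_of_lipschitzOn (f := fun u : ℝ => β k (fun _ : Fin (k + 1) => u)) hγ (div_nonneg hC h1θ.le : 0 ≤ C / (1 - θ))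
      (fun u u' hu huγ hu' hu'γ => by
        have h := abs_const_sub_const_le hL hΛ hθ0 hθ1 hC hu huγ hu' hu'γ k
        calc |β k (fun _ : Fin (k + 1) => u) - β k (fun _ : Fin (k + 1) => u')| ≤ C * |u - u'| / (1 - θ) := h
          _ = C / (1 - θ) * |u - u'| := by ring)
    exact ⟨b, fun u hu huγ => (hb u hu huγ).trans (le_of_eq (by ring))⟩
  choose b0 hb0 using h
  exact ⟨b0, hb0⟩

/-- Uniqueness AT ONE SCALE, with possibly different constants and boxes: two numbers approached linearly by `u ↦ β_{k+1}(u,…,u)` at `0⁺` coincide. [folklore] -/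
theorem zeroHist_unique_at {k : ℕ} {γ₁ γ₂ K₁ K₂ b₁ b₂ : ℝ} (hγ₁ : 0 < γ₁) (hγ₂ : 0 < γ₂) (hK₁ : 0 ≤ K₁) (hK₂ : 0 ≤ K₂)
    (h₁ : ∀ u : ℝ, 0 < u → u ≤ γ₁ → |β k (fun _ : Fin (k + 1) => u) - b₁| ≤ K₁ * u)
    (h₂ : ∀ u : ℝ, 0 < u → u ≤ γ₂ → |β k (fun _ : Fin (k + 1) => u) - b₂| ≤ K₂ * u) : b₁ = b₂ :=
  eq_of_abs_sub_le_linear (f := fun u : ℝ => β k (fun _ : Fin (k + 1) => u)) (lt_min hγ₁ hγ₂) hK₁ hK₂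
    (fun u hu huγ => h₁ u hu (huγ.trans (min_le_left _ _))) (fun u hu huγ => h₂ u hu (huγ.trans (min_le_right _ _)))

/-- **THE ZERO-HISTORY VALUES ARE UNIQUE**: any two sequences with the displayed property (for the same `C, θ, γ`) are equal. [folklore] -/
theorem zeroHist_unique (hθ1 : θ < 1) (hC : 0 ≤ C) (hγ : 0 < γ) {b0 b0' : ℕ → ℝ}
    (hb0 : ∀ (k : ℕ) (u : ℝ), 0 < u → u ≤ γ → |β k (fun _ : Fin (k + 1) => u) - b0 k| ≤ C * u / (1 - θ))
    (hb0' : ∀ (k : ℕ) (u : ℝ), 0 < u → u ≤ γ → |β k (fun _ : Fin (k + 1) => u) - b0' k| ≤ C * u / (1 - θ)) : b0 = b0' := by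
  have h1θ : 0 < 1 - θ := by linarith
  have hK : 0 ≤ C / (1 - θ) := div_nonneg hC h1θ.le
  funext k
  exact zeroHist_unique_at hγ hγ hK hK (fun u hu huγ => (hb0 k u hu huγ).trans (le_of_eq (by ring)))
    (fun u hu huγ => (hb0' k u hu huγ).trans (le_of_eq (by ring)))

/-- As a limit: `β_{k+1}(u,…,u) → b⁰_k` as `u → 0⁺`, for every k. [folklore] -/
theorem tendsto_const_zeroHist (hθ1 : θ < 1) (hC : 0 ≤ C) (hγ : 0 < γ) {b0 : ℕ → ℝ}
    (hb0 : ∀ (k : ℕ) (u : ℝ), 0 < u → u ≤ γ → |β k (fun _ : Fin (k + 1) => u) - b0 k| ≤ C * u / (1 - θ)) (k : ℕ) :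
    Tendsto (fun u : ℝ => β k (fun _ : Fin (k + 1) => u)) (𝓝[>] 0) (𝓝 (b0 k)) := by
  have h1θ : 0 < 1 - θ := by linarith
  exact tendsto_of_abs_sub_le_linear hγ (div_nonneg hC h1θ.le)
    (fun u hu huγ => (hb0 k u hu huγ).trans (le_of_eq (by ring)))

/-! ## §2 The fading corner bound — the intrinsic (AF-1) -/

/-- **THE CORNER BOUND WITH THE MODULI THEMSELVES**: for every `v ∈ ]0, γ]^{k+1}`, `|β_{k+1}(v) − b⁰_k| ≤ Σ_{i≤k} Λ_{k,i}·v_i` — compare `v` with the constant history `(u,…,u)`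
(`|v_i − u| ≤ v_i + u`), use `hb0` at `u`, and let `u → 0⁺` (the extra terms are `≤ 2Cu∕(1−θ)`).  The history term `β_{k+1}(v) − b⁰_k` VANISHES AT THE ZERO CORNER at the rate of the
moduli: [I]'s "β¹_{k+1} = 0 at g_k = 0" ((2.14) p. 268) in intrinsic form. [cite: Balaban1987RG1, (2.12)-(2.14) p.268 and §5 p.298] -/
theorem abs_sub_zeroHist_le_sum_moduli (hL : HistLipschitz Λ γ β) (hΛ : FadingMemory C θ Λ) (hθ0 : 0 ≤ θ) (hθ1 : θ < 1) (hC : 0 ≤ C)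
    (hγ : 0 < γ) {b0 : ℕ → ℝ}
    (hb0 : ∀ (k : ℕ) (u : ℝ), 0 < u → u ≤ γ → |β k (fun _ : Fin (k + 1) => u) - b0 k| ≤ C * u / (1 - θ))
    {k : ℕ} {v : Fin (k + 1) → ℝ} (hv : v ∈ Box γ k) :
    |β k v - b0 k| ≤ ∑ i : Fin (k + 1), Λ k i * v i := by
  have h1θ : 0 < 1 - θ := by linarith
  refine le_of_forall_pos_le_add fun ε hε => ?_
  obtain ⟨u, hu, huγ, hsmall⟩ := exists_small_const hγ hC hθ1 hε
  have hcu : (fun _ : Fin (k + 1) => u) ∈ Box γ k := mem_box.mpr fun _ => ⟨hu, huγ⟩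
  have hLip := hL k v (fun _ : Fin (k + 1) => u) hv hcu
  have hterm : ∀ i : Fin (k + 1), Λ k i * |v i - u| ≤ Λ k i * v i + Λ k i * u := by
    intro i
    have hΛi : 0 ≤ Λ k i := (hΛ k i (Nat.le_of_lt_succ i.isLt)).1
    have hvi := mem_box.mp hv i
    have habs : |v i - u| ≤ v i + u := abs_sub_le_iff.mpr ⟨by linarith, by linarith [hvi.1]⟩
    nlinarith
  have hsum : ∑ i : Fin (k + 1), Λ k i * |v i - u| ≤ ∑ i : Fin (k + 1), Λ k i * v i + u * ∑ i : Fin (k + 1), Λ k i := by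
    calc ∑ i : Fin (k + 1), Λ k i * |v i - u| ≤ ∑ i : Fin (k + 1), (Λ k i * v i + Λ k i * u) := Finset.sum_le_sum fun i _ => hterm i
      _ = ∑ i : Fin (k + 1), Λ k i * v i + u * ∑ i : Fin (k + 1), Λ k i := by
          rw [Finset.sum_add_distrib, Finset.mul_sum]
          exact congrArg _ (Finset.sum_congr rfl fun i _ => mul_comm _ _)
  have hrow := rowSum_le hθ0 hθ1 hC hΛ k
  have h0 := hb0 k u hu huγ
  have htri := abs_sub_le (β k v) (β k (fun _ : Fin (k + 1) => u)) (b0 k)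
  have hextra : u * ∑ i : Fin (k + 1), Λ k i + C * u / (1 - θ) ≤ ε := by
    have h1 : u * ∑ i : Fin (k + 1), Λ k i ≤ u * (C / (1 - θ)) := mul_le_mul_of_nonneg_left hrow hu.le
    have h2 : u * (C / (1 - θ)) + C * u / (1 - θ) = 2 * C * u / (1 - θ) := by ring
    linarith
  linarith [hLip, hsum, h0, htri, hextra]

/-- **THE FADING CORNER BOUND**: `|β_{k+1}(v) − b⁰_k| ≤ C·Σ_{i≤k} θ^{k−i}·v_i` on ]0, γ]^{k+1} — the influence of the coupling of age `k − i` on the distance to the zero-history value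
decays like `θ^{k−i}` (the intrinsic, FADING form of (AF-1); bflow-p1's `abs_sub_valueAtZero_le` is the same shape for a functional on infinite histories). [cite: Balaban1987RG1, (2.14) p.268 and §5 p.298] -/
theorem abs_sub_zeroHist_le_sum_geom (hL : HistLipschitz Λ γ β) (hΛ : FadingMemory C θ Λ) (hθ0 : 0 ≤ θ) (hθ1 : θ < 1) (hC : 0 ≤ C)
    (hγ : 0 < γ) {b0 : ℕ → ℝ}
    (hb0 : ∀ (k : ℕ) (u : ℝ), 0 < u → u ≤ γ → |β k (fun _ : Fin (k + 1) => u) - b0 k| ≤ C * u / (1 - θ))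
    {k : ℕ} {v : Fin (k + 1) → ℝ} (hv : v ∈ Box γ k) :
    |β k v - b0 k| ≤ C * ∑ i : Fin (k + 1), θ ^ (k - (i : ℕ)) * v i := by
  refine (abs_sub_zeroHist_le_sum_moduli hL hΛ hθ0 hθ1 hC hγ hb0 hv).trans ?_
  rw [Finset.mul_sum]
  refine Finset.sum_le_sum fun i _ => ?_
  have h := hΛ k i (Nat.le_of_lt_succ i.isLt)
  have hvi := (mem_box.mp hv i).1.le
  calc Λ k i * v i ≤ C * θ ^ (k - (i : ℕ)) * v i := mul_le_mul_of_nonneg_right h.2 hvi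
    _ = C * (θ ^ (k - (i : ℕ)) * v i) := by ring

/-- On a small box: `|β_{k+1}(v) − b⁰_k| ≤ Cδ∕(1−θ)` for `v ∈ ]0, δ]^{k+1}`, `0 < δ ≤ γ` (each `v_i ≤ δ`; the row sum of the moduli is `≤ C∕(1−θ)`). [folklore] -/
theorem abs_sub_zeroHist_le_box (hL : HistLipschitz Λ γ β) (hΛ : FadingMemory C θ Λ) (hθ0 : 0 ≤ θ) (hθ1 : θ < 1) (hC : 0 ≤ C)
    (hγ : 0 < γ) {b0 : ℕ → ℝ}
    (hb0 : ∀ (k : ℕ) (u : ℝ), 0 < u → u ≤ γ → |β k (fun _ : Fin (k + 1) => u) - b0 k| ≤ C * u / (1 - θ))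
    {δ : ℝ} (hδ : 0 < δ) (hδγ : δ ≤ γ) {k : ℕ} {v : Fin (k + 1) → ℝ} (hv : v ∈ Box δ k) :
    |β k v - b0 k| ≤ C * δ / (1 - θ) := by
  refine (abs_sub_zeroHist_le_sum_moduli hL hΛ hθ0 hθ1 hC hγ hb0 (box_mono hδγ k hv)).trans ?_
  have hterm : ∀ i : Fin (k + 1), Λ k i * v i ≤ Λ k i * δ := fun i =>
    mul_le_mul_of_nonneg_left (mem_box.mp hv i).2 (hΛ k i (Nat.le_of_lt_succ i.isLt)).1
  calc ∑ i : Fin (k + 1), Λ k i * v i ≤ ∑ i : Fin (k + 1), Λ k i * δ := Finset.sum_le_sum fun i _ => hterm i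
    _ = δ * ∑ i : Fin (k + 1), Λ k i := by rw [Finset.mul_sum]; exact Finset.sum_congr rfl fun i _ => mul_comm _ _
    _ ≤ δ * (C / (1 - θ)) := mul_le_mul_of_nonneg_left (rowSum_le hθ0 hθ1 hC hΛ k) hδ.le
    _ = C * δ / (1 - θ) := by ring

/-- **THE PRINTED (AF-1) SHAPE ALONG NON-DECREASING HISTORIES**: if `v ∈ ]0, γ]^{k+1}` is non-decreasing (`v_i ≤ v_j` for `i ≤ j` — the shape of a forward run with `β ≥ 0`), then
`|β_{k+1}(v) − b⁰_k| ≤ C·v_k∕(1−θ)`: the history term is bounded by the LAST coupling, [I]'s "|β¹_{k+1}| ≤ O(g_k)" (tree: `B12Beta.af1_of_vanish_lipschitz`'s conclusion shape).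
On general histories only the fading form holds. [cite: Balaban1987RG1, (2.14) p.268 and §1 p.264] -/
theorem abs_sub_zeroHist_le_last_of_monotone (hL : HistLipschitz Λ γ β) (hΛ : FadingMemory C θ Λ) (hθ0 : 0 ≤ θ) (hθ1 : θ < 1)
    (hC : 0 ≤ C) (hγ : 0 < γ) {b0 : ℕ → ℝ}
    (hb0 : ∀ (k : ℕ) (u : ℝ), 0 < u → u ≤ γ → |β k (fun _ : Fin (k + 1) => u) - b0 k| ≤ C * u / (1 - θ))
    {k : ℕ} {v : Fin (k + 1) → ℝ} (hv : v ∈ Box γ k) (hmono : Monotone v) :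
    |β k v - b0 k| ≤ C * v (Fin.last k) / (1 - θ) := by
  refine (abs_sub_zeroHist_le_sum_moduli hL hΛ hθ0 hθ1 hC hγ hb0 hv).trans ?_
  have hlast : 0 ≤ v (Fin.last k) := (mem_box.mp hv (Fin.last k)).1.le
  have hterm : ∀ i : Fin (k + 1), Λ k i * v i ≤ Λ k i * v (Fin.last k) := fun i =>
    mul_le_mul_of_nonneg_left (hmono (Fin.le_last i)) (hΛ k i (Nat.le_of_lt_succ i.isLt)).1
  calc ∑ i : Fin (k + 1), Λ k i * v i ≤ ∑ i : Fin (k + 1), Λ k i * v (Fin.last k) := Finset.sum_le_sum fun i _ => hterm i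
    _ = v (Fin.last k) * ∑ i : Fin (k + 1), Λ k i := by
        rw [Finset.mul_sum]; exact Finset.sum_congr rfl fun i _ => mul_comm _ _
    _ ≤ v (Fin.last k) * (C / (1 - θ)) := mul_le_mul_of_nonneg_left (rowSum_le hθ0 hθ1 hC hΛ k) hlast
    _ = C * v (Fin.last k) / (1 - θ) := by ring

/-! ## §3 With NE4: the zero-history values obey the intrinsic (AF-0r) and converge to part 11's `b⋆` -/

/-- **INTRINSIC (AF-0r): NE4 ⟹ `|b⁰_{k+1} − b⁰_k| ≤ cθ^k`.**  The scale-shift rate `ScaleShiftRate c θ γ β` compares `β_{k+2}` and `β_{k+1}` on the constant histories `(u,…,u)`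
(`Fin.tail` of a constant history is constant); let `u → 0⁺` through `hb0`.  The zero-history values are a Cauchy sequence at NE4's rate — the β sub-cell's (AF-0r) for
`β⁰_{k+1}`, here a THEOREM about the intrinsic values of any β carrying the letters (for Bałaban's β nothing is asserted). [cite: Balaban1987RG1, (2.12) p.268; King1986, Thm 3.4 (3.9) p.656] -/
theorem abs_zeroHist_succ_sub_le (hS : ScaleShiftRate c θ γ β) (hθ1 : θ < 1) (hC : 0 ≤ C) (hγ : 0 < γ) {b0 : ℕ → ℝ}
    (hb0 : ∀ (k : ℕ) (u : ℝ), 0 < u → u ≤ γ → |β k (fun _ : Fin (k + 1) => u) - b0 k| ≤ C * u / (1 - θ)) (k : ℕ) :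
    |b0 (k + 1) - b0 k| ≤ c * θ ^ k := by
  have h1θ : 0 < 1 - θ := by linarith
  refine le_of_forall_pos_le_add fun ε hε => ?_
  obtain ⟨u, hu, huγ, hsmall⟩ := exists_small_const hγ hC hθ1 hε
  have hw : (fun _ : Fin (k + 1 + 1) => u) ∈ Box γ (k + 1) := mem_box.mpr fun _ => ⟨hu, huγ⟩
  have hss : |β (k + 1) (fun _ : Fin (k + 1 + 1) => u) - β k (Fin.tail (fun _ : Fin (k + 1 + 1) => u))| ≤ c * θ ^ k :=
    hS k _ hw
  have htail : Fin.tail (fun _ : Fin (k + 1 + 1) => u) = fun _ : Fin (k + 1) => u := rfl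
  rw [htail] at hss
  have h1 := hb0 (k + 1) u hu huγ
  have h2 := hb0 k u hu huγ
  have htri : |b0 (k + 1) - b0 k| ≤ |β (k + 1) (fun _ : Fin (k + 1 + 1) => u) - b0 (k + 1)| +
      |β (k + 1) (fun _ : Fin (k + 1 + 1) => u) - β k (fun _ : Fin (k + 1) => u)| + |β k (fun _ : Fin (k + 1) => u) - b0 k| := by
    have e : b0 (k + 1) - b0 k = -(β (k + 1) (fun _ : Fin (k + 1 + 1) => u) - b0 (k + 1)) +
        (β (k + 1) (fun _ : Fin (k + 1 + 1) => u) - β k (fun _ : Fin (k + 1) => u)) + (β k (fun _ : Fin (k + 1) => u) - b0 k) := by ring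
    rw [e]
    refine (abs_add_le _ _).trans (add_le_add ((abs_add_le _ _).trans (add_le_add (le_of_eq (abs_neg _)) le_rfl)) le_rfl)
  have hextra : C * u / (1 - θ) + C * u / (1 - θ) ≤ ε := by
    have h2 : C * u / (1 - θ) + C * u / (1 - θ) = 2 * C * u / (1 - θ) := by ring
    linarith
  linarith [htri, h1, h2, hss, hextra]

/-- **THE ZERO-HISTORY VALUES CONVERGE TO `b⋆` AT NE4's RATE: `|b⁰_k − b⋆| ≤ cθ^k∕(1−θ)`**, with `b⋆` part 11's asymptotic constant (`hb`): through the constant history `(u,…,u)` —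
`|β_{k+1}(u,…) − b⁰_k| ≤ Cu∕(1−θ)`, NE4's tail `|β_{k+1}(u,…) − betaInf β (u,u,…)| ≤ cθ^k∕(1−θ)` (part 11 ∕ node U2 BY NAME), `|betaInf β (u,u,…) − b⋆| ≤ Cu∕(1−θ)` — and `u → 0⁺`.  So
the gaps cell's «binf = lim β⁰» and part 11f's `limit_eq_bstar` hold for the INTRINSIC one-loop coefficients of any β with the letters: `lim_k b⁰_k = b⋆`. [cite: Balaban1987RG1, (2.12) p.268 and Thm 2 p.259] -/
theorem abs_zeroHist_sub_bstar_le (hS : ScaleShiftRate c θ γ β) (hθ1 : θ < 1) (hC : 0 ≤ C) (hγ : 0 < γ) {b0 : ℕ → ℝ}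
    (hb0 : ∀ (k : ℕ) (u : ℝ), 0 < u → u ≤ γ → |β k (fun _ : Fin (k + 1) => u) - b0 k| ≤ C * u / (1 - θ)) {bstar : ℝ}
    (hb : ∀ u : ℝ, 0 < u → u ≤ γ → |betaInf β (fun _ : ℕ => u) - bstar| ≤ C * u / (1 - θ)) (k : ℕ) :
    |b0 k - bstar| ≤ c * θ ^ k / (1 - θ) := by
  have h1θ : 0 < 1 - θ := by linarith
  refine le_of_forall_pos_le_add fun ε hε => ?_
  obtain ⟨u, hu, huγ, hsmall⟩ := exists_small_const hγ hC hθ1 hε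
  have h1 := hb0 k u hu huγ
  have h2 := abs_const_sub_betaInf_le hS hθ1 hu huγ k
  have h3 := hb u hu huγ
  have htri : |b0 k - bstar| ≤ |β k (fun _ : Fin (k + 1) => u) - b0 k| +
      |β k (fun _ : Fin (k + 1) => u) - betaInf β (fun _ : ℕ => u)| + |betaInf β (fun _ : ℕ => u) - bstar| := by
    have e : b0 k - bstar = -(β k (fun _ : Fin (k + 1) => u) - b0 k) +
        (β k (fun _ : Fin (k + 1) => u) - betaInf β (fun _ : ℕ => u)) + (betaInf β (fun _ : ℕ => u) - bstar) := by ring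
    rw [e]
    refine (abs_add_le _ _).trans (add_le_add ((abs_add_le _ _).trans (add_le_add (le_of_eq (abs_neg _)) le_rfl)) le_rfl)
  have hextra : C * u / (1 - θ) + C * u / (1 - θ) ≤ ε := by
    have h2 : C * u / (1 - θ) + C * u / (1 - θ) = 2 * C * u / (1 - θ) := by ring
    linarith
  linarith [htri, h1, h2, h3, hextra]

/-- As a limit: `b⁰_k → b⋆` as `k → ∞` (0 ≤ θ < 1). [folklore] -/
theorem tendsto_zeroHist_bstar (hS : ScaleShiftRate c θ γ β) (hθ0 : 0 ≤ θ) (hθ1 : θ < 1) (hC : 0 ≤ C) (hγ : 0 < γ) {b0 : ℕ → ℝ}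
    (hb0 : ∀ (k : ℕ) (u : ℝ), 0 < u → u ≤ γ → |β k (fun _ : Fin (k + 1) => u) - b0 k| ≤ C * u / (1 - θ)) {bstar : ℝ}
    (hb : ∀ u : ℝ, 0 < u → u ≤ γ → |betaInf β (fun _ : ℕ => u) - bstar| ≤ C * u / (1 - θ)) :
    Tendsto b0 atTop (𝓝 bstar) := by
  have hrate : Tendsto (fun k : ℕ => c * θ ^ k / (1 - θ)) atTop (𝓝 0) := by
    have h := ((tendsto_pow_atTop_nhds_zero_of_lt_one hθ0 hθ1).const_mul c).div_const (1 - θ)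
    simpa using h
  rw [← tendsto_sub_nhds_zero_iff]
  exact squeeze_zero_norm (fun k => by rw [Real.norm_eq_abs]; exact abs_zeroHist_sub_bstar_le hS hθ1 hC hγ hb0 hb k) hrate

/-- Conversely, ANY limit of the zero-history values IS part 11's asymptotic constant (so `b⋆` can be read off the intrinsic one-loop coefficients without node U2's `betaInf`). [folklore] -/
theorem limit_zeroHist_eq_bstar (hS : ScaleShiftRate c θ γ β) (hθ0 : 0 ≤ θ) (hθ1 : θ < 1) (hC : 0 ≤ C) (hγ : 0 < γ) {b0 : ℕ → ℝ}
    (hb0 : ∀ (k : ℕ) (u : ℝ), 0 < u → u ≤ γ → |β k (fun _ : Fin (k + 1) => u) - b0 k| ≤ C * u / (1 - θ)) {bstar : ℝ}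
    (hb : ∀ u : ℝ, 0 < u → u ≤ γ → |betaInf β (fun _ : ℕ => u) - bstar| ≤ C * u / (1 - θ)) {L : ℝ}
    (hL : Tendsto b0 atTop (𝓝 L)) : L = bstar := tendsto_nhds_unique hL (tendsto_zeroHist_bstar hS hθ0 hθ1 hC hγ hb0 hb)

/-! ## §4 The three-term normal form: the sandwich halves, the scale term is summable, row (iv) sees only the history term -/

/-- **THE SANDWICH WITH HALF THE HISTORY CONSTANT.**  Under the moduli + NE4 + `b⋆` and `0 < δ ≤ γ`: `|β_{k+1}(v) − b⋆| ≤ Cδ∕(1−θ) + cθ^k∕(1−θ)` for EVERY `v ∈ ]0, δ]^{k+1}` —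
through the zero history instead of the constant history at the level (part 11's `abs_beta_sub_bstar_le` has `2Cδ∕(1−θ)`). [folklore] -/
theorem abs_beta_sub_bstar_le' (hL : HistLipschitz Λ γ β) (hΛ : FadingMemory C θ Λ) (hS : ScaleShiftRate c θ γ β)
    (hθ0 : 0 ≤ θ) (hθ1 : θ < 1) (hC : 0 ≤ C) (hγ : 0 < γ) {bstar : ℝ}
    (hb : ∀ u : ℝ, 0 < u → u ≤ γ → |betaInf β (fun _ : ℕ => u) - bstar| ≤ C * u / (1 - θ))
    {δ : ℝ} (hδ : 0 < δ) (hδγ : δ ≤ γ) {k : ℕ} {v : Fin (k + 1) → ℝ} (hv : v ∈ Box δ k) :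
    |β k v - bstar| ≤ C * δ / (1 - θ) + c * θ ^ k / (1 - θ) := by
  obtain ⟨b0, hb0⟩ := exists_zeroHist hL hΛ hθ0 hθ1 hC hγ
  have h1 := abs_sub_zeroHist_le_box hL hΛ hθ0 hθ1 hC hγ hb0 hδ hδγ hv
  have h2 := abs_zeroHist_sub_bstar_le hS hθ1 hC hγ hb0 hb k
  have htri := abs_sub_le (β k v) (b0 k) bstar
  linarith

/-- **THE SCALE TERM IS SUMMABLE**: `Σ_{j∈[k,n)} |b⁰_j − b⋆| ≤ cθ^k∕(1−θ)²` (geometric tail; in particular `≤ c∕(1−θ)²` for every window). [folklore] -/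
theorem sum_abs_zeroHist_sub_bstar_le (hS : ScaleShiftRate c θ γ β) (hθ0 : 0 ≤ θ) (hθ1 : θ < 1) (hC : 0 ≤ C) (hγ : 0 < γ) {b0 : ℕ → ℝ}
    (hb0 : ∀ (k : ℕ) (u : ℝ), 0 < u → u ≤ γ → |β k (fun _ : Fin (k + 1) => u) - b0 k| ≤ C * u / (1 - θ)) {bstar : ℝ}
    (hb : ∀ u : ℝ, 0 < u → u ≤ γ → |betaInf β (fun _ : ℕ => u) - bstar| ≤ C * u / (1 - θ)) (k n : ℕ) :
    ∑ j ∈ Ico k n, |b0 j - bstar| ≤ c * θ ^ k / (1 - θ) ^ 2 := by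
  have h1θ : 0 < 1 - θ := by linarith
  have hc : 0 ≤ c := constant_nonneg_of_scaleShiftRate hS hγ
  calc ∑ j ∈ Ico k n, |b0 j - bstar| ≤ ∑ j ∈ Ico k n, c * θ ^ j / (1 - θ) :=
        Finset.sum_le_sum fun j _ => abs_zeroHist_sub_bstar_le hS hθ1 hC hγ hb0 hb j
    _ = c / (1 - θ) * ∑ j ∈ Ico k n, θ ^ j := by
        rw [Finset.mul_sum]; exact Finset.sum_congr rfl fun j _ => by ring
    _ ≤ c / (1 - θ) * (θ ^ k / (1 - θ)) :=
        mul_le_mul_of_nonneg_left (geom_sum_Ico_le_of_lt_one hθ0 hθ1) (div_nonneg hc h1θ.le)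
    _ = c * θ ^ k / (1 - θ) ^ 2 := by rw [div_mul_div_comm, sq]

/-- **THE WINDOW SUMS IN NORMAL FORM.**  For ANY coupling sequence `gs` and `k ≤ n`:
`|Σ_{j∈[k,n)} β_{j+1}(gs_{≤j}) − (b⋆·(n−k) + Σ_{j∈[k,n)} (β_{j+1}(gs_{≤j}) − b⁰_j))| ≤ cθ^k∕(1−θ)²` — the window sums that K1⁹'s row (iv) bounds are the drift `b⋆(n−k)` plus the
window sums of the HISTORY TERM, up to the summable scale term. [cite: Balaban1987RG1, Thm 2 (0.31) p.259 with (0.20) p.256] -/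
theorem abs_windowSum_sub_le (hS : ScaleShiftRate c θ γ β) (hθ0 : 0 ≤ θ) (hθ1 : θ < 1) (hC : 0 ≤ C) (hγ : 0 < γ) {b0 : ℕ → ℝ}
    (hb0 : ∀ (k : ℕ) (u : ℝ), 0 < u → u ≤ γ → |β k (fun _ : Fin (k + 1) => u) - b0 k| ≤ C * u / (1 - θ)) {bstar : ℝ}
    (hb : ∀ u : ℝ, 0 < u → u ≤ γ → |betaInf β (fun _ : ℕ => u) - bstar| ≤ C * u / (1 - θ))
    (gs : ℕ → ℝ) {k n : ℕ} (hkn : k ≤ n) :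
    |∑ j ∈ Ico k n, β j (prefixOf gs j) - (bstar * ((n : ℝ) - k) + ∑ j ∈ Ico k n, (β j (prefixOf gs j) - b0 j))| ≤
      c * θ ^ k / (1 - θ) ^ 2 := by
  have e : ∑ j ∈ Ico k n, β j (prefixOf gs j) - (bstar * ((n : ℝ) - k) + ∑ j ∈ Ico k n, (β j (prefixOf gs j) - b0 j)) =
      ∑ j ∈ Ico k n, (b0 j - bstar) := by
    rw [Finset.sum_sub_distrib, Finset.sum_sub_distrib, Finset.sum_const, Nat.card_Ico, nsmul_eq_mul, Nat.cast_sub hkn]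
    ring
  rw [e]
  exact (Finset.abs_sum_le_sum_abs _ _).trans (sum_abs_zeroHist_sub_bstar_le hS hθ0 hθ1 hC hγ hb0 hb k n)

end

end Summit.QuantumFields.BalabanUV.Beta.EriceFlowEnclosureB12AsPrintedPointwiseFadingZeroHistory
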